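import Summits.QuantumFields.BalabanUV.Beta.SpineRecursiveT2AllComb
import Summits.QuantumFields.BalabanUV.Beta.SpineRecursiveWEndSym
import Summits.QuantumFields.BalabanUV.Beta.SpineRecursiveWEnd

/-!
# `BalabanUV.Beta.SpineRecursiveWEndComb` — binder row D1, RULING R-D1-g35-1 (chart (III′)), brick P6-5: **THE (Wr-conj-c) LAW OF THE SLOTTED W-TABLES AT THE COMB-CHART
# RESOLVENTS, EVERY LEVEL, FROM THE LETTERS — ROOT CURRENCY** — the (III′) twin of `SpineRecursiveWEndSym` (gen 31, (N7d)): **`WrecOf_brefC_of_letters_comb`** over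
# `SpineRecursiveT2AllComb.T2RecOf_bref_all_of_letters_comb` (the induction) + `SpineRecursiveWLawComb.WrecOf_bref_of_T2RM_comb` + the comb-chart (c1)′ fold
# `LagrangeFoldComb.dM_SpureRecOf_M1Of_eq_vertexOfK_SrecOf_comb`; `Gsym ↦ GcombSh`, `Dsh ↦ Dsh Lc`; `vertexOfK_smul_diagK_ctGenM` (resolvent-generic) is chart (II)'s BY NAME

HONEST FRAMING (cell charter, verbatim): «discharging BetaPertH makes Bałaban's UV stability UNCONDITIONAL — a real constructive-QFT result; it is
NOT the continuum limit and NOT the Clay problem.»  HONEST DEPENDENCY: continuum YM on T⁴ ⇐ BetaPertH ∧ nine spine estimates (0/9 proved); BetaPertH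
⇐ (D1) ∧ (D4) ∧ CAP+tail; G-an2-4 gates asym, D1 and NE2/3/4.  DERIVED cell leaf (wiring, [folklore]; β sub-cell, row-D1 OWNER `b2b-balaban-beta-an2` gen 36, programme
P6); no statement of Bałaban's papers, no `[cite:]`, no `def`, no `Prop` fact; EVERY table LETTER IS A HYPOTHESIS; instantiates no binder of the wall.  RECORD = ROOT M′
p303989 (chart (II)) unchanged.  NOT D1, NOT `BetaPertH`, NOT continuum, NOT Clay.
Provenance: β sub-cell, unit beta-an2 gen 36, 2026-08-22 (v1); text of `SpineRecursiveWEndSym` transformed by name; no existing file touched.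
-/

open Finset
open scoped BigOperators
open Literature.Probability.LatticeModels (Torus.proj)
open Literature.MathematicalPhysics.QuantumFieldTheory
open Literature.MathematicalPhysics.QuantumFieldTheory.Balaban1983to89
open Literature.MathematicalPhysics.QuantumFieldTheory.Balaban1983to89.Beta
open ExpKernelCalculus (MKer Decays BiLoc comp VertexFamily)
open PolarizationSign (reflSign)
open KernelReflection (refK)
open ResolventReflection (bref Φ)
open OneStepResolventKernel (Fib LocStencil)
open OneStepKernelFamily (KInvStep colH vertexOfK)
open BalabanStepJetsSucc (mmRead wE wVH)
open BalabanStepW2 (M2Of wV4 wB2)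
open BalabanCompositeJets (LocStencil₂)
open SecondOrderResponse (dM W2OfK LocStencilFM)
open Summit.QuantumFields.BalabanUV.Beta.TameKernelCalculus
open Summit.QuantumFields.BalabanUV.Beta.ChartConjugation (conjV conjW)
open Summit.QuantumFields.BalabanUV.Beta.BorderedHessian (bhK diagK stepScale)
open Summit.QuantumFields.BalabanUV.Beta.SymSliceProjectorKernel (symEc)
open Summit.QuantumFields.BalabanUV.Beta.WardLocusCubic (mmSym)
open Summit.QuantumFields.BalabanUV.Beta.WardLocusRecursive (SrecOf)
open Summit.QuantumFields.BalabanUV.Beta.ChartConjugationDefectEnd (sandwichDefect)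
open Summit.QuantumFields.BalabanUV.Beta.CombChartStepJets (GcombSh)
open Summit.QuantumFields.BalabanUV.Beta.DshAn1 (Dsh spr_Dsh)
open Summit.QuantumFields.BalabanUV.Beta.SymShiftedSpread (bhKStepSh)
open Summit.QuantumFields.BalabanUV.Beta.E3ContactGenerator (ctGenM)
open Summit.QuantumFields.BalabanUV.Beta.VertexReflectionContact (smul_diagK)
open Summit.QuantumFields.BalabanUV.Beta.LagrangeFoldComb (dM_SpureRecOf_M1Of_eq_vertexOfK_SrecOf_comb)

open Summit.QuantumFields.BalabanUV.Beta.AxialDressingRooted (one_le_of_neZero)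

noncomputable section

namespace Summit.QuantumFields.BalabanUV.Beta.SpineRooted

section WEndComb

variable {d Lc : ℕ} [NeZero Lc]

/-- [folklore] **THE (Wr-conj-c) LAW OF THE SLOTTED W-TABLES AT THE SYMMETRISED RESOLVENTS, EVERY LEVEL, FROM THE LETTERS — ROOT CURRENCY**
(see the module docstring; hypotheses EXACTLY those of `T2RecOf_bref_all_of_letters_comb`). -/
theorem WrecOf_brefC_of_letters_comb (hLc : Odd Lc)
    {V H : Fin (d + 1) → (Fin (d + 1) → ℤ) → MKer (d + 1) (Fib d)}
    (hV : ∀ δ : ℝ, 0 ≤ δ → ∃ C : ℝ, LocStencil V C δ) (hH : ∀ δ : ℝ, 0 ≤ δ → ∃ C : ℝ, VertexFamily H Lc C δ)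
    (hV0 : ∀ (κ : Fin (d + 1)) (w x z : Fin (d + 1) → ℤ) (β β' : Fin (d + 1)), V κ w x z (Sum.inl β) (Sum.inl β') = 0)
    (hHr : ∀ (α μ : Fin (d + 1)) (y : Fin (d + 1) → ℤ), H μ (bref α μ y) = reflSign α μ • refK (Φ (d := d) Lc α) (H μ y))
    (cE cVH cΛ cE₂ cB : ℝ) (T : Fin 4 → Fin 4 → Fin 4 → Fin 4 → ℝ)
    {vh₂S : Fin (d + 1) → (Fin (d + 1) → ℤ) → Fin (d + 1) → (Fin (d + 1) → ℤ) → MKer (d + 1) (Fib d)} (hB2 : ∃ C δ : ℝ, 0 < δ ∧ LocStencil₂ vh₂S C δ)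
    (hB0 : ∀ κ u κ' u' (x z : Fin (d + 1) → ℤ) (β β' : Fin (d + 1)), vh₂S κ u κ' u' x z (Sum.inl β) (Sum.inl β') = 0)
    {mixFF : Fin (d + 1) → (Fin (d + 1) → ℤ) → Fin (d + 1) → (Fin (d + 1) → ℤ) → MKer (d + 1) (Fib d)} (hmix : ∃ C δ : ℝ, 0 < δ ∧ LocStencilFM Lc mixFF C δ)
    (γ : ℕ → ℝ)
    (hlock : ∀ j, cE * wE d Lc (j + 1) * (γ j / (stepScale d Lc j * (Lc : ℝ) ^ (d + 1))) / wVH d Lc (j + 1) = γ (j + 1))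
    (hlock2 : ∀ j, cE₂ * wV4 d Lc (j + 1) * wVH d Lc (j + 1) = (cE * wE d Lc (j + 1)) ^ 2)
    (hSp : ∀ (j : ℕ) (α κ : Fin (d + 1)) (u : Fin (d + 1) → ℤ), SpureRecOf d Lc V H (GcombSh Lc) cE cVH cΛ j κ (bref α κ u) = reflSign α κ • refK (Φ Lc α)
      (SpureRecOf d Lc V H (GcombSh Lc) cE cVH cΛ j κ u + conjV (bhKStepSh d Lc (Dsh Lc) j) (diagK fun p c => γ j * ctGenM d (bhK Lc + Dsh Lc) α Lc κ u p c)))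
    (h : ℕ → Fin (d + 1) → Fin (d + 1) → (Fin (d + 1) → ℤ) → Fin (d + 1) → (Fin (d + 1) → ℤ) → (Fin (d + 1) → ℤ) → Fib d → ℝ)
    (R2 : ℕ → Fin (d + 1) → Fin (d + 1) → (Fin (d + 1) → ℤ) → Fin (d + 1) → (Fin (d + 1) → ℤ) → MKer (d + 1) (Fib d))
    (RM : ℕ → Fin (d + 1) → Fin (d + 1) → (Fin (d + 1) → ℤ) → Fin (d + 1) → (Fin (d + 1) → ℤ) → MKer (d + 1) (Fib d))
    (h0 : ∀ (α κ : Fin (d + 1)) (u : Fin (d + 1) → ℤ) (κ' : Fin (d + 1)) (u' : Fin (d + 1) → ℤ),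
      T2RecOf d Lc (GcombSh Lc) (SpureRecOf d Lc V H (GcombSh Lc) cE cVH cΛ) (M1Of d Lc H cΛ) cE₂ cB T vh₂S mixFF 0 κ (bref α κ u) κ' (bref α κ' u') =
        (reflSign α κ * reflSign α κ') • refK (Φ Lc α)
          (T2RecOf d Lc (GcombSh Lc) (SpureRecOf d Lc V H (GcombSh Lc) cE cVH cΛ) (M1Of d Lc H cΛ) cE₂ cB T vh₂S mixFF 0 κ u κ' u' +
            conjW (bhKStepSh d Lc (Dsh Lc) 0) (SpureRecOf d Lc V H (GcombSh Lc) cE cVH cΛ 0 κ u) (SpureRecOf d Lc V H (GcombSh Lc) cE cVH cΛ 0 κ' u')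
              (diagK fun p c => γ 0 * ctGenM d (bhK Lc + Dsh Lc) α Lc κ u p c) (diagK fun p c => γ 0 * ctGenM d (bhK Lc + Dsh Lc) α Lc κ' u' p c) (diagK (h 0 α κ u κ' u')) +
            R2 0 α κ u κ' u'))
    (hM2 : ∀ (j : ℕ) (α κ : Fin (d + 1)) (u : Fin (d + 1) → ℤ) (ρ : Fin (d + 1)) (w : Fin (d + 1) → ℤ),
      M2Of d Lc mixFF j κ (bref α κ u) ρ (bref α ρ w) =
        (reflSign α κ * reflSign α ρ) • refK (Φ Lc α)
          (M2Of d Lc mixFF j κ u ρ w + conjV (M1Of d Lc H cΛ j ρ w) (diagK fun p c => γ j * ctGenM d (bhK Lc + Dsh Lc) α Lc κ u p c) + RM j α κ u ρ w))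
    (X2s : ℕ → Fin (d + 1) → Fin (d + 1) → (Fin (d + 1) → ℤ) → Fin (d + 1) → (Fin (d + 1) → ℤ) → (Fin (d + 1) → ℤ) → Fib d → ℝ)
    (Δ : ℕ → Fin (d + 1) → Fin (d + 1) → (Fin (d + 1) → ℤ) → Fin (d + 1) → (Fin (d + 1) → ℤ) → MKer (d + 1) (Fib d))
    (hsplit : ∀ (j : ℕ) (α μ : Fin (d + 1)) (y : Fin (d + 1) → ℤ) (ν : Fin (d + 1)) (y' : Fin (d + 1) → ℤ),
      W2OfK (GcombSh (d := d) Lc j) Lc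
          (fun κ u => SpureRecOf d Lc V H (GcombSh Lc) cE cVH cΛ j κ u + conjV (bhKStepSh d Lc (Dsh Lc) j) (diagK fun p c => γ j * ctGenM d (bhK Lc + Dsh Lc) α Lc κ u p c))
          (M1Of d Lc H cΛ j)
          (fun κ u κ' u' => T2RecOf d Lc (GcombSh Lc) (SpureRecOf d Lc V H (GcombSh Lc) cE cVH cΛ) (M1Of d Lc H cΛ) cE₂ cB T vh₂S mixFF j κ u κ' u' +
            conjW (bhKStepSh d Lc (Dsh Lc) j) (SpureRecOf d Lc V H (GcombSh Lc) cE cVH cΛ j κ u) (SpureRecOf d Lc V H (GcombSh Lc) cE cVH cΛ j κ' u')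
              (diagK fun p c => γ j * ctGenM d (bhK Lc + Dsh Lc) α Lc κ u p c) (diagK fun p c => γ j * ctGenM d (bhK Lc + Dsh Lc) α Lc κ' u' p c) (diagK (h j α κ u κ' u')) +
            R2 j α κ u κ' u')
          (fun κ u ρ w => M2Of d Lc mixFF j κ u ρ w + conjV (M1Of d Lc H cΛ j ρ w) (diagK fun p c => γ j * ctGenM d (bhK Lc + Dsh Lc) α Lc κ u p c) + RM j α κ u ρ w)
          μ y ν y' =
        W2OfK (GcombSh (d := d) Lc j) Lc (SpureRecOf d Lc V H (GcombSh Lc) cE cVH cΛ j) (M1Of d Lc H cΛ j) (T2RecOf d Lc (GcombSh Lc) (SpureRecOf d Lc V H (GcombSh Lc) cE cVH cΛ) (M1Of d Lc H cΛ) cE₂ cB T vh₂S mixFF j) (M2Of d Lc mixFF j) μ y ν y' +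
          conjW (bhKStepSh d Lc (Dsh Lc) j)
            (dM (GcombSh Lc j) Lc (SpureRecOf d Lc V H (GcombSh Lc) cE cVH cΛ j) (M1Of d Lc H cΛ j) μ y) (dM (GcombSh Lc j) Lc (SpureRecOf d Lc V H (GcombSh Lc) cE cVH cΛ j) (M1Of d Lc H cΛ j) ν y')
            (diagK fun p c => ∑ κ, ∑' u, colH (GcombSh Lc j) Lc μ y κ u * (γ j * ctGenM d (bhK Lc + Dsh Lc) α Lc κ u p c)) (diagK fun p c => ∑ κ, ∑' u, colH (GcombSh Lc j) Lc ν y' κ u * (γ j * ctGenM d (bhK Lc + Dsh Lc) α Lc κ u p c))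
            (diagK (X2s j α μ y ν y')) +
          Δ j α μ y ν y')
    (hDg : ∀ (j : ℕ) (α ν : Fin (d + 1)) (y' : Fin (d + 1) → ℤ),
      Loc (dM (GcombSh (d := d) Lc j) Lc (fun κ u => SpureRecOf d Lc V H (GcombSh Lc) cE cVH cΛ j κ u + conjV (bhKStepSh d Lc (Dsh Lc) j) (diagK fun p c => γ j * ctGenM d (bhK Lc + Dsh Lc) α Lc κ u p c)) (M1Of d Lc H cΛ j) ν y'))
    (hX2L : ∀ j α μ y ν y', Loc (diagK (X2s j α μ y ν y'))) (hΔL : ∀ j α μ y ν y', Loc (Δ j α μ y ν y'))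
    (RB : ℕ → Fin (d + 1) → Fin (d + 1) → (Fin (d + 1) → ℤ) → Fin (d + 1) → (Fin (d + 1) → ℤ) → MKer (d + 1) (Fib d))
    (hRBff : ∀ j α κ u κ' u' (x z : Fin (d + 1) → ℤ) (β β' : Fin (d + 1)), RB j α κ u κ' u' x z (Sum.inl β) (Sum.inl β') = 0)
    (hBfm : ∀ (j : ℕ) (α : Fin (d + 1)) κ u κ' u' (x z : Fin (d + 1) → ℤ) (β m : Fin (d + 1)),
      ((cB * wB2 d Lc (j + 1)) • vh₂S κ (bref α κ u) κ' (bref α κ' u')) x z (Sum.inl β) (Sum.inr m) =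
        ((reflSign α κ * reflSign α κ') • refK (Φ Lc α) ((cB * wB2 d Lc (j + 1)) • vh₂S κ u κ' u' +
          conjW (bhKStepSh d Lc (Dsh Lc) (j + 1)) (SpureRecOf d Lc V H (GcombSh Lc) cE cVH cΛ (j + 1) κ u) (SpureRecOf d Lc V H (GcombSh Lc) cE cVH cΛ (j + 1) κ' u')
            (diagK fun p c => γ (j + 1) * ctGenM d (bhK Lc + Dsh Lc) α Lc κ u p c) (diagK fun p c => γ (j + 1) * ctGenM d (bhK Lc + Dsh Lc) α Lc κ' u' p c)
            (diagK (h (j + 1) α κ u κ' u')) + RB (j + 1) α κ u κ' u')) x z (Sum.inl β) (Sum.inr m))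
    (hBmf : ∀ (j : ℕ) (α : Fin (d + 1)) κ u κ' u' (x z : Fin (d + 1) → ℤ) (m β : Fin (d + 1)),
      ((cB * wB2 d Lc (j + 1)) • vh₂S κ (bref α κ u) κ' (bref α κ' u')) x z (Sum.inr m) (Sum.inl β) =
        ((reflSign α κ * reflSign α κ') • refK (Φ Lc α) ((cB * wB2 d Lc (j + 1)) • vh₂S κ u κ' u' +
          conjW (bhKStepSh d Lc (Dsh Lc) (j + 1)) (SpureRecOf d Lc V H (GcombSh Lc) cE cVH cΛ (j + 1) κ u) (SpureRecOf d Lc V H (GcombSh Lc) cE cVH cΛ (j + 1) κ' u')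
            (diagK fun p c => γ (j + 1) * ctGenM d (bhK Lc + Dsh Lc) α Lc κ u p c) (diagK fun p c => γ (j + 1) * ctGenM d (bhK Lc + Dsh Lc) α Lc κ' u' p c)
            (diagK (h (j + 1) α κ u κ' u')) + RB (j + 1) α κ u κ' u')) x z (Sum.inr m) (Sum.inl β))
    (hBmm : ∀ (j : ℕ) (α : Fin (d + 1)) κ u κ' u' (x z : Fin (d + 1) → ℤ) (m m' : Fin (d + 1)),
      ((cB * wB2 d Lc (j + 1)) • vh₂S κ (bref α κ u) κ' (bref α κ' u')) x z (Sum.inr m) (Sum.inr m') =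
        ((reflSign α κ * reflSign α κ') • refK (Φ Lc α) ((cB * wB2 d Lc (j + 1)) • vh₂S κ u κ' u' +
          conjW (bhKStepSh d Lc (Dsh Lc) (j + 1)) (SpureRecOf d Lc V H (GcombSh Lc) cE cVH cΛ (j + 1) κ u) (SpureRecOf d Lc V H (GcombSh Lc) cE cVH cΛ (j + 1) κ' u')
            (diagK fun p c => γ (j + 1) * ctGenM d (bhK Lc + Dsh Lc) α Lc κ u p c) (diagK fun p c => γ (j + 1) * ctGenM d (bhK Lc + Dsh Lc) α Lc κ' u' p c)
            (diagK (h (j + 1) α κ u κ' u')) + RB (j + 1) α κ u κ' u')) x z (Sum.inr m) (Sum.inr m'))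
    (hR2succ : ∀ (j : ℕ) (α κ : Fin (d + 1)) (u : Fin (d + 1) → ℤ) (κ' : Fin (d + 1)) (u' : Fin (d + 1) → ℤ),
      R2 (j + 1) α κ u κ' u' =
          (-((cE₂ * wV4 d Lc (j + 1)) • mmRead Lc
              (comp (comp (GcombSh Lc j) (((1 / 2 : ℝ) • conjV (bhKStepSh d Lc (Dsh Lc) j) (diagK fun p a => X2s j α κ' u' κ u p a - X2s j α κ u κ' u' p a) +
                (1 / 2 : ℝ) • (Δ j α κ u κ' u' + Δ j α κ' u' κ u)))) (GcombSh Lc j) -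
                (comp (sandwichDefect (GcombSh Lc j) (bhKStepSh d Lc (Dsh Lc) j)
                      (diagK fun p c => ∑ ι, ∑' v, colH (GcombSh Lc j) Lc κ u ι v * (γ j * ctGenM d (bhK Lc + Dsh Lc) α Lc ι v p c)))
                    (comp (dM (GcombSh Lc j) Lc (SpureRecOf d Lc V H (GcombSh Lc) cE cVH cΛ j) (M1Of d Lc H cΛ j) κ' u') (GcombSh Lc j) -
                      diagK fun p c => ∑ ι, ∑' v, colH (GcombSh Lc j) Lc κ' u' ι v * (γ j * ctGenM d (bhK Lc + Dsh Lc) α Lc ι v p c))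
                  + comp (comp (GcombSh Lc j) (dM (GcombSh Lc j) Lc (SpureRecOf d Lc V H (GcombSh Lc) cE cVH cΛ j) (M1Of d Lc H cΛ j) κ u +
                      conjV (bhKStepSh d Lc (Dsh Lc) j) (diagK fun p c => ∑ ι, ∑' v, colH (GcombSh Lc j) Lc κ u ι v * (γ j * ctGenM d (bhK Lc + Dsh Lc) α Lc ι v p c))))
                    (sandwichDefect (GcombSh Lc j) (bhKStepSh d Lc (Dsh Lc) j)
                      (diagK fun p c => ∑ ι, ∑' v, colH (GcombSh Lc j) Lc κ' u' ι v * (γ j * ctGenM d (bhK Lc + Dsh Lc) α Lc ι v p c)))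
                  + comp (sandwichDefect (GcombSh Lc j) (bhKStepSh d Lc (Dsh Lc) j)
                      (diagK fun p c => ∑ ι, ∑' v, colH (GcombSh Lc j) Lc κ' u' ι v * (γ j * ctGenM d (bhK Lc + Dsh Lc) α Lc ι v p c)))
                    (comp (dM (GcombSh Lc j) Lc (SpureRecOf d Lc V H (GcombSh Lc) cE cVH cΛ j) (M1Of d Lc H cΛ j) κ u) (GcombSh Lc j) -
                      diagK fun p c => ∑ ι, ∑' v, colH (GcombSh Lc j) Lc κ u ι v * (γ j * ctGenM d (bhK Lc + Dsh Lc) α Lc ι v p c))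
                  + comp (comp (GcombSh Lc j) (dM (GcombSh Lc j) Lc (SpureRecOf d Lc V H (GcombSh Lc) cE cVH cΛ j) (M1Of d Lc H cΛ j) κ' u' +
                      conjV (bhKStepSh d Lc (Dsh Lc) j) (diagK fun p c => ∑ ι, ∑' v, colH (GcombSh Lc j) Lc κ' u' ι v * (γ j * ctGenM d (bhK Lc + Dsh Lc) α Lc ι v p c))))
                    (sandwichDefect (GcombSh Lc j) (bhKStepSh d Lc (Dsh Lc) j)
                      (diagK fun p c => ∑ ι, ∑' v, colH (GcombSh Lc j) Lc κ u ι v * (γ j * ctGenM d (bhK Lc + Dsh Lc) α Lc ι v p c)))))) +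
            RB (j + 1) α κ u κ' u' +
            conjV (mmRead Lc (GcombSh (d := d) Lc j))
              (diagK fun p c => cE₂ * wV4 d Lc (j + 1) * mmSym Lc (X2s j α κ u κ' u') p c - wVH d Lc (j + 1) * h (j + 1) α κ u κ' u' p c))) :
    ∀ (j : ℕ) (α μ : Fin (d + 1)) (y : Fin (d + 1) → ℤ) (ν : Fin (d + 1)) (y' : Fin (d + 1) → ℤ),
      WrecOf d Lc (GcombSh Lc) (SpureRecOf d Lc V H (GcombSh Lc) cE cVH cΛ) (M1Of d Lc H cΛ) cE₂ cB T vh₂S mixFF j μ (bref α μ y) ν (bref α ν y') =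
        (reflSign α μ * reflSign α ν) • refK (Φ Lc α)
          (WrecOf d Lc (GcombSh Lc) (SpureRecOf d Lc V H (GcombSh Lc) cE cVH cΛ) (M1Of d Lc H cΛ) cE₂ cB T vh₂S mixFF j μ y ν y' +
            conjW (bhKStepSh d Lc (Dsh Lc) j)
              (vertexOfK (GcombSh (d := d) Lc j) Lc (SrecOf d Lc V H (GcombSh Lc) cE cVH cΛ j) μ y)
              (vertexOfK (GcombSh (d := d) Lc j) Lc (SrecOf d Lc V H (GcombSh Lc) cE cVH cΛ j) ν y')
              (vertexOfK (GcombSh (d := d) Lc j) Lc (fun κ u => γ j • diagK (ctGenM d (bhK Lc + Dsh Lc) α Lc κ u)) μ y)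
              (vertexOfK (GcombSh (d := d) Lc j) Lc (fun κ u => γ j • diagK (ctGenM d (bhK Lc + Dsh Lc) α Lc κ u)) ν y')
              (diagK (X2s j α μ y ν y')) +
            ((1 / 2 : ℝ) • conjV (bhKStepSh d Lc (Dsh Lc) j) (diagK fun p a => X2s j α ν y' μ y p a - X2s j α μ y ν y' p a) +
              (1 / 2 : ℝ) • (Δ j α μ y ν y' + Δ j α ν y' μ y))) := by
  intro j α μ y ν y'
  have hT2 := T2RecOf_bref_all_of_letters_comb hLc hV hH hV0 hHr cE cVH cΛ cE₂ cB T hB2 hB0 hmix γ hlock hlock2 hSp h R2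
    RM h0 hM2 X2s Δ hsplit hDg hX2L hΔL RB hRBff hBfm hBmf hBmm hR2succ
  rw [← dM_SpureRecOf_M1Of_eq_vertexOfK_SrecOf_comb hV hH cE cVH cΛ j μ y, ← dM_SpureRecOf_M1Of_eq_vertexOfK_SrecOf_comb hV hH cE cVH cΛ j ν y',
    vertexOfK_smul_diagK_ctGenM, vertexOfK_smul_diagK_ctGenM]
  exact WrecOf_bref_of_T2RM_comb hLc hHr cE cVH cΛ cE₂ cB T vh₂S mixFF γ j α (hSp j α) (h j α) (R2 j α) (RM j α) (hT2 j α) (hM2 j α) (X2s j α)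
    (Δ j α) (hsplit j α) (hDg j α) μ y ν y'

end WEndComb

end Summit.QuantumFields.BalabanUV.Beta.SpineRooted

end
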